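import Summits.Ventures.PercRepro.LemmaBPlusFaces

/-!
# The face condition on natural-number codes: what the kernel actually evaluates

Kernel reduction does not memoise: a value used `r` times is recomputed `r` times, and a lookup into
a configuration synthesised from enumeration variables costs far more than a lookup into a literal.
So the decided statement works on codes: configurations are bit codes read by `Nat.testBit`
(`cfgOf`; `cfgEquiv : Fin (2^k) ≃ Config (Fin k)` through Mathlib's `finFunctionFinEquiv`),
intervals are bit containment (`subMask_iff`), the antipode is a bit operation (`antipodeCode`,
`cfgOf_antipodeCode`), the six connection atoms of a configuration are packed once into a `6`-bit
code (`atomsCode`, `row4Code`), the rows of ALL `2^k` configurations are computed once into a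
base-`16` table (`rowTable`, `rowAt_rowTable`) and forced to a literal (`withLitB`), and the kernel
`K⁺ + 1 ∈ {0,1,2}` is read by one shift-and-mask from a packed constant (`phiPlusPacked`,
`phiPlusEntry_eq`).  **`facesCheck G m = true`** is the Boolean the kernel evaluates;
**`facesBPlus_of_facesCheck`** is the bridge back to `FacesBPlus` (hence to `c011_of_facesBPlus`).
-/

namespace PercRepro

namespace MultiGraph

variable {V E : Type*} (G : MultiGraph V E) [DecidableEq V] [Fintype V] [Fintype E] [DecidableEq E]

/-- Force a natural number to a literal before it is used (`match` evaluates it once). -/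
def withLit (x : ℕ) (f : ℕ → ℕ) : ℕ :=
  match x with
  | 0 => f 0
  | y + 1 => f (y + 1)

omit [DecidableEq V] [Fintype V] [Fintype E] [DecidableEq E] in
/-- `withLit` is function application. -/
theorem withLit_eq (x : ℕ) (f : ℕ → ℕ) : withLit x f = f x := by
  cases x <;> rfl

/-- The configuration on `Fin k` with the bits of the code `a`. -/
def cfgOf (k : ℕ) (a : ℕ) : Config (Fin k) := fun e => a.testBit e.val

/-- The antipode inside `[v, u]` on bit codes: `v ∨ (u ∧ ¬n)` (bits `< k`). -/
def antipodeCode (k u v n : ℕ) : ℕ := v ||| (u &&& ((2 ^ k - 1) ^^^ n))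

omit [DecidableEq V] [Fintype V] [Fintype E] [DecidableEq E] in
/-- The antipode on codes is the antipode of the configurations. -/
theorem cfgOf_antipodeCode (k u v n : ℕ) :
    cfgOf k (antipodeCode k u v n) = antipode (cfgOf k u) (cfgOf k v) (cfgOf k n) := by
  funext e
  simp only [cfgOf, antipodeCode, antipode, Nat.testBit_or, Nat.testBit_and, Nat.testBit_xor,
    Nat.testBit_two_pow_sub_one, e.isLt, decide_true, Bool.true_xor]
  cases v.testBit e.val <;> cases u.testBit e.val <;> cases n.testBit e.val <;> rfl

/-- The integer kernel `K⁺ + 1 ∈ {0, 1, 2}` packed into 2-bit fields of one natural number at the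
codes `s * 15 + t` (`K⁺ = phiPlusKernelZ`): a single shift-and-mask reads an entry, so the code — hence
the two rows — is evaluated ONCE under kernel reduction (the kernel accelerates `Nat.shiftRight`,
`Nat.land`, `Nat.mul`, `Nat.add` on literals). -/
def phiPlusPacked : ℕ := 969118299060809187399098410517339379138188480916424080227076991015263074916135886552893539163231307610436229331485052545877582653248853

/-- The packed entry `K⁺(s, t) + 1` at a code `c = s * 15 + t`. -/
def phiPlusEntry (c : ℕ) : ℕ := (phiPlusPacked >>> (2 * c)) &&& 3

omit [DecidableEq V] [Fintype V] [Fintype E] [DecidableEq E] in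
/-- The packed entry at the code of `(s, t)` is `K⁺(s, t) + 1` (`225` cases). -/
theorem phiPlusEntry_eq (s t : Fin 15) :
    (phiPlusEntry (s.val * 15 + t.val) : ℤ) = phiPlusKernelZ s t + 1 := by
  revert s t
  decide +kernel

/-- The six connection atoms of the marks (order `pair4`), packed into a `6`-bit code. -/
def atomsCode (m : Fin 4 → V) (ω : Config E) : ℕ :=
  ∑ a : Fin 6, if G.connD ω (m (pair4 a).1) (m (pair4 a).2) then 2 ^ a.val else 0

omit [DecidableEq V] [Fintype V] [Fintype E] [DecidableEq E] in
/-- Reading the bits of a packed `6`-bit code gives the bits back (`64` cases). -/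
theorem testBit_atoms (b : Fin 6 → Bool) :
    (fun a : Fin 6 => (∑ a' : Fin 6, if b a' then 2 ^ a'.val else 0).testBit a.val) = b := by
  revert b
  decide +kernel

/-- The computable row as a natural number: the atoms code is evaluated once, then decoded. -/
def row4Code (m : Fin 4 → V) (ω : Config E) : ℕ :=
  withLit (G.atomsCode m ω) fun c => (rowOf4 fun a => c.testBit a.val).val

omit [DecidableEq E] in
/-- `row4Code` is the value of `row4D`. -/
theorem row4Code_eq (m : Fin 4 → V) (ω : Config E) : G.row4Code m ω = (G.row4D m ω).val := by
  unfold row4Code row4D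
  rw [withLit_eq]
  congr 2
  exact testBit_atoms fun a => G.connD ω (m (pair4 a).1) (m (pair4 a).2)

end MultiGraph

/-! ### The face condition on codes, for graphs on `Fin k` edges: one row table, bit-op intervals -/

namespace MultiGraph

variable {V : Type*} {k : ℕ} (G : MultiGraph V (Fin k)) [DecidableEq V] [Fintype V]

/-- Codes are configurations: `Fin (2 ^ k) ≃ Config (Fin k)`, through Mathlib's
`finFunctionFinEquiv` (base `2`) and `finTwoEquiv`. -/
def cfgEquiv (k : ℕ) : Fin (2 ^ k) ≃ Config (Fin k) :=
  finFunctionFinEquiv.symm.trans (Equiv.piCongrRight fun _ => finTwoEquiv)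

omit [DecidableEq V] [Fintype V] in
/-- The equivalence reads the bits: `cfgEquiv k a = cfgOf k a`. -/
theorem cfgEquiv_apply (a : Fin (2 ^ k)) : cfgEquiv k a = cfgOf k a.val := by
  funext e
  show finTwoEquiv (finFunctionFinEquiv.symm a e) = a.val.testBit e.val
  rw [Nat.testBit_eq_decide_div_mod_eq]
  show ((⟨a.val / 2 ^ e.val % 2, _⟩ : Fin 2) == 1) = decide (a.val / 2 ^ e.val % 2 = 1)
  rw [Bool.eq_iff_iff, beq_iff_eq, decide_eq_true_iff, Fin.ext_iff, Fin.val_one]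

omit [DecidableEq V] [Fintype V] in
/-- Every configuration is a code below `2 ^ k`. -/
theorem exists_cfgOf (ω : Config (Fin k)) : ∃ a : Fin (2 ^ k), cfgOf k a.val = ω := by
  obtain ⟨a, ha⟩ := (cfgEquiv k).surjective ω
  exact ⟨a, by rw [← cfgEquiv_apply, ha]⟩

omit [DecidableEq V] [Fintype V] in
/-- Sums over configurations are sums over codes. -/
theorem sum_cfgOf {M : Type*} [AddCommMonoid M] (f : Config (Fin k) → M) :
    ∑ a : Fin (2 ^ k), f (cfgOf k a.val) = ∑ ω : Config (Fin k), f ω := by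
  rw [← Equiv.sum_comp (cfgEquiv k) f]
  exact Finset.sum_congr rfl fun a _ => by rw [cfgEquiv_apply]

omit [DecidableEq V] [Fintype V] in
/-- The product order on configurations is bit containment of the codes: `v ≤ n` iff
`v &&& n = v` (for `v < 2 ^ k`). -/
theorem subMask_iff {v : ℕ} (hv : v < 2 ^ k) (n : ℕ) :
    v &&& n = v ↔ cfgOf k v ≤ cfgOf k n := by
  rw [Config.le_iff]
  constructor
  · intro h e he
    have := congrArg (fun x => x.testBit e.val) h
    simp only [Nat.testBit_and, cfgOf] at this he ⊢
    rw [he] at this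
    simpa using this.symm
  · intro h
    apply Nat.eq_of_testBit_eq
    intro i
    rw [Nat.testBit_and]
    by_cases hi : i < k
    · have := h ⟨i, hi⟩
      simp only [cfgOf] at this
      cases hvi : v.testBit i
      · rfl
      · simpa using this hvi
    · have hlt : v < 2 ^ i := lt_of_lt_of_le hv (Nat.pow_le_pow_right (by norm_num) (not_lt.mp hi))
      rw [Nat.testBit_lt_two_pow hlt]
      rfl

/-- The rows of all `2 ^ k` configurations as `Fin 16` digits. -/
def rowDigit (m : Fin 4 → V) (n : Fin (2 ^ k)) : Fin 16 :=
  ⟨G.row4Code m (cfgOf k n.val), by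
    rw [row4Code_eq]; exact lt_trans (G.row4D m (cfgOf k n.val)).isLt (by norm_num)⟩

/-- **The row table**: all rows packed as base-`16` digits of one natural number
(`Σ_n row(n) · 16^n`, Mathlib's `finFunctionFinEquiv`); computed ONCE and forced to a literal. -/
def rowTable (m : Fin 4 → V) : ℕ := (finFunctionFinEquiv (G.rowDigit m)).val

/-- Reading digit `n` of a table. -/
def rowAt (T n : ℕ) : ℕ := T / 16 ^ n % 16

/-- The table reads back the rows. -/
theorem rowAt_rowTable (m : Fin 4 → V) (n : Fin (2 ^ k)) :
    rowAt (G.rowTable m) n.val = G.row4Code m (cfgOf k n.val) := by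
  have h := congrArg (fun f => (f n).val)
    (Equiv.symm_apply_apply finFunctionFinEquiv (G.rowDigit m))
  exact h

omit [DecidableEq V] [Fintype V] in
/-- Forcing a table to a literal before a Boolean check. -/
def withLitB (x : ℕ) (f : ℕ → Bool) : Bool :=
  match x with
  | 0 => f 0
  | y + 1 => f (y + 1)

omit [DecidableEq V] [Fintype V] in
/-- `withLitB` is function application. -/
theorem withLitB_eq (x : ℕ) (f : ℕ → Bool) : withLitB x f = f x := by
  cases x <;> rfl

omit [DecidableEq V] [Fintype V] in
/-- The number of points of the interval `[v, u]`, on codes (bit containment). -/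
def faceSizeM (k : ℕ) (u v : ℕ) : ℕ :=
  ∑ n : Fin (2 ^ k), if v &&& n.val = v ∧ n.val &&& u = n.val then 1 else 0

omit [DecidableEq V] [Fintype V] in
/-- The face score on codes from a row table `T`: the packed entries `K⁺ + 1` summed over the
interval `[v, u]`, both rows read from the table. -/
def faceScoreT (k : ℕ) (T : ℕ) (u v : ℕ) : ℕ :=
  ∑ n : Fin (2 ^ k), if v &&& n.val = v ∧ n.val &&& u = n.val then
    phiPlusEntry (rowAt T n.val * 15 + rowAt T (antipodeCode k u v n.val))
  else 0

/-- **The kernel check**: the row table once, then every face `[v, u]` (codes, `v &&& u = v`)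
has score ≥ size. -/
def facesCheck (m : Fin 4 → V) : Bool :=
  withLitB (G.rowTable m) fun T =>
    decide (∀ u v : Fin (2 ^ k), v.val &&& u.val = v.val →
      faceSizeM k u.val v.val ≤ faceScoreT k T u.val v.val)

omit [DecidableEq V] [Fintype V] in
/-- The antipode code stays below `2 ^ k`. -/
theorem antipodeCode_lt {u v : ℕ} (hu : u < 2 ^ k) (hv : v < 2 ^ k) (n : ℕ) :
    antipodeCode k u v n < 2 ^ k :=
  Nat.or_lt_two_pow hv (lt_of_le_of_lt Nat.and_le_left hu)

/-- **The face slack is score − size** read from the row table. -/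
theorem faceSlackZ_eq_table (m : Fin 4 → V) (u v : Fin (2 ^ k)) :
    G.faceSlackZ m (cfgOf k u.val) (cfgOf k v.val) =
      (faceScoreT k (G.rowTable m) u.val v.val : ℤ) - faceSizeM k u.val v.val := by
  unfold faceSlackZ faceScoreT faceSizeM
  rw [Finset.sum_filter, ← sum_cfgOf]
  push_cast
  rw [← Finset.sum_sub_distrib]
  refine Finset.sum_congr rfl fun n _ => ?_
  have hc : (cfgOf k v.val ≤ cfgOf k n.val ∧ cfgOf k n.val ≤ cfgOf k u.val) ↔
      (v.val &&& n.val = v.val ∧ n.val &&& u.val = n.val) := by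
    rw [subMask_iff v.isLt, subMask_iff n.isLt]
  rw [if_congr hc rfl rfl]
  split_ifs with h
  · have ha := antipodeCode_lt u.isLt v.isLt n.val
    rw [rowAt_rowTable, ← cfgOf_antipodeCode,
      show antipodeCode k u.val v.val n.val = (⟨_, ha⟩ : Fin (2 ^ k)).val from rfl,
      rowAt_rowTable, row4Code_eq, row4Code_eq, phiPlusEntry_eq]
    ring
  · simp

/-- **From the kernel check to the face condition**: `facesCheck = true` (decided by the kernel)
gives Lemma B⁺ on every face of `G`. -/
theorem facesBPlus_of_facesCheck (m : Fin 4 → V) (h : G.facesCheck m = true) :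
    G.FacesBPlus m := by
  unfold facesCheck at h
  rw [withLitB_eq, decide_eq_true_iff] at h
  intro u v hvu
  obtain ⟨a, rfl⟩ := exists_cfgOf u
  obtain ⟨b, rfl⟩ := exists_cfgOf v
  have hab := h a b ((subMask_iff b.isLt a.val).mpr hvu)
  rw [faceSlackZ_eq_table]
  have : (faceSizeM k a.val b.val : ℤ) ≤ faceScoreT k (G.rowTable m) a.val b.val := by
    exact_mod_cast hab
  linarith

end MultiGraph

end PercRepro
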